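import Literature.NumberTheory.EllipticCurves.HeegnerPointsKolyvaginEulerSystem
import Literature.NumberTheory.EllipticCurves.CuspFormLFunctionLevelConductorProofs
import Literature.NumberTheory.EllipticCurves.TorsionFrobeniusProofs
import Literature.NumberTheory.EllipticCurves.RootNumberProofs
import Literature.NumberTheory.EllipticCurves.GlobalMinimalModelProofs
import Literature.NumberTheory.EllipticCurves.QuadraticTwistKroneckerLFunctionProofs
import Literature.NumberTheory.DiophantineGeometry.LocalReductionProofs
import Literature.NumberTheory.DiophantineGeometry.LocalReductionFiniteBadPlacesProofs
import Literature.NumberTheory.DiophantineGeometry.EllArithGlue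
import Mathlib.NumberTheory.RamificationInertia.Valuation
import Literature.NumberTheory.DiophantineGeometry.ConductorExponentZeroProofs
import Literature.NumberTheory.DiophantineGeometry.ConductorFactorizationProofs
import HarnessLib

/-!
# Good reduction at Kolyvagin primes (Gross 1991, §3 (3.1) with §1: `ℓ ∤ N = N_E`)

Groundwork for the leaves `Literature.NumberTheory.EllipticCurves.Gross1991_prop_8_2` and
`Gross1991_kolyvaginClasses` (`HeegnerPointsKolyvaginEulerSystem`) of the decomposition of
Gross 1991, Prop. 2.3 (`Gross1991_prop_2_3`). Everything here is **proved**; no definition, no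
named fact (D-0026).

Gross 1991, §1 (PDF p. 213 of the held volume `book:editornd-l-functions-arithmetic`): *"let `E`
be a modular elliptic curve of conductor `N`"* (the level of the modular parametrisation
`X₀(N) → E` is the conductor); §3 (3.1) (PDF p. 216): *"`ℓ` does not divide `N·D·p`"*; and this is
how §7 (*"Let `E` be an elliptic curve … with good reduction"* at `λ`, PDF p. 224) and Prop. 8.1 /
Prop. 6.2 (Néron models at `λ`) apply at every Kolyvagin prime. In the tree the standing
hypotheses of Prop. 2.3 carry the modular parametrisation inside `IsHeegnerPoint N W K P`, as a
`ModularParametrizationData W N` whose newform `f ∈ S₂(Γ₀(N))` has `aₙ(f) = aₙ(W)`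
(`IsNewformOf W f`); the equality `N = N_W` itself is Carayol's theorem (the tree's named fact
`IsNewformOf.level_eq_conductorNorm`), but its prime-divisor part is a theorem of the tree
(`IsNewformOf.dvd_level_iff_dvd_conductorNorm`, by comparing `a_{ℓ²}(f)` and `a_{ℓ²}(E)`), and
that is all (3.1) needs:

* `hasGoodReductionAt_of_isNewformOf_of_not_dvd` — if `f ∈ S₂(Γ₀(N))` is the newform of the
  elliptic `W/ℚ` and `ℓ ∤ N`, then `W` has good reduction at the place of `ℚ` over `ℓ`
  (`ℓ ∤ N_W`, then `f_ℓ = 0` ⟺ good reduction: the tree's `factorization_conductorNorm_holds`,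
  `conductorExponent_eq_zero_iff_holds` (Silverman ATAEC IV.10.2(a)), transported from the places
  of `ℤ` to those of `𝓞 ℚ` as in `hasGoodReductionAt_of_not_dvd_conductorNorm` of
  `NonvanishingTwistsWaldspurgerOfHoffsteinLuo`, which is not imported here to keep the
  Waldspurger/BSD files out of the Kolyvagin cluster);
* `IsKolyvaginPrime.hasGoodReductionAt_rat` — hence **`E` has good reduction at every Kolyvagin
  prime** `ℓ` for `(N, W, K, p)` whenever `P` is a Heegner point of level `N` on `W` over `K`;
* `hasGoodReductionAt_baseChange_of_hasGoodReductionAt_rat` — **base change of good reduction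
  from `ℚ` to a number field `K` in any universe**: if `W/ℚ` has good reduction at `v` then `W/K`
  has good reduction at every `w ∣ v`. (The tree's `hasGoodReductionAt_baseChange_of_hasGoodReductionAt`,
  `LocalH1TateDualityLangTateProofs`, is stated for `K L : Type u` in one universe because the map of
  completions `adicCompletionMap` of `ShaRestriction` is; the leaves have `K : Type u` with `ℚ : Type`,
  so a completion-free proof is given here: pass to a global minimal model `C • W` over `ℚ`
  (`hasGlobalMinimalModel_rat_holds`, Silverman VIII.8.3), whose coefficients are integers and whose
  discriminant is a `v`-unit (`hasGoodReductionAt_iff_of_isMinimalAt`), base-change the rational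
  isomorphism `C`, and read good reduction at `w` off `w(aᵢ) ≤ 1`, `w(Δ) = v(Δ)^e = 1`
  (`hasGoodReductionAt_of_valuation_le_one_of_valuation_Δ_eq_one`, Silverman VIII.1 Remark 1.3;
  Mathlib `valuation_liesOver`).)
* `IsKolyvaginPrime.not_mem_badPlaces` — hence **`λ = (ℓ)` is not a bad place of `W/K`** at a
  Kolyvagin prime `ℓ`.

These feed the local lemmas at `λ` that require `λ ∉ badPlaces` and `p ∉ λ`:
`inertia_le_torsionFixing` (`HeegnerPointsKolyvaginLocalCriterion`), `selmerLocalKer_eq_unramifiedKer`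
(`SelmerLocalConditionGoodReductionProofs`), `InertiaTameFactorizationProofs`.

## References

* B. H. Gross, *Kolyvagin's work on modular elliptic curves*, in *`L`-functions and arithmetic
  (Durham, 1989)*, LMS Lecture Note Ser. 153, CUP (1991), 235–256: §1, §3 (3.1), §7 (held
  `book:editornd-l-functions-arithmetic`, PDF pp. 213, 216, 224). [GrossLMS1991]
* F. Diamond, J. Shurman, *A first course in modular forms*, GTM 228 (2005), Prop. 5.8.5, (8.44),
  §8.3. [DiamondShurman2005]
* J. H. Silverman, *Advanced Topics in the Arithmetic of Elliptic Curves* (1994), IV.10.2(a);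
  *The Arithmetic of Elliptic Curves*, 2nd ed. (2009), VII.5.1(a), VIII.1 Remark 1.3, VIII.8.3.
  [Silverman1994] [SilvermanAEC2009]
-/

noncomputable section

open scoped Classical
open WeierstrassCurve NumberField IsDedekindDomain Rat.HeightOneSpectrum
open Literature.NumberTheory.EllipticCurves.ModularForms

universe u

namespace Literature.NumberTheory.EllipticCurves

/-! ## Good reduction away from the level of the newform -/

/-- **Good reduction away from the level of the newform** (Gross 1991, §1 "modular elliptic curve
of conductor `N`" with §3 (3.1) `ℓ ∤ N`; Diamond–Shurman §8.3: "`E` has good reduction at all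
primes `p` not dividing `N_E`"). If `f ∈ S₂(Γ₀(N))` is the newform of the elliptic `W/ℚ`
(`IsNewformOf W f`) and `ℓ ∤ N` is prime, then `W` has good reduction at the place `v ∋ ℓ` of `ℚ`:
`ℓ ∤ N_W` (`IsNewformOf.dvd_level_iff_dvd_conductorNorm`), so `f_ℓ = 0`
(`factorization_conductorNorm_holds`), so good reduction at the place of `ℤ`
(`conductorExponent_eq_zero_iff_holds`), transported to the place of `𝓞 ℚ`
(`hasGoodReductionAtPrime_iff_hasGoodReductionAt_holds`,
`hasGoodReductionAtPrime_iff_hasGoodReductionAt_ringOfIntegers`).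
[cite: GrossLMS1991, §3 (3.1) with §1] [cite: DiamondShurman2005, §8.3] -/
theorem hasGoodReductionAt_of_isNewformOf_of_not_dvd {N : ℕ} [NeZero N] (W : WeierstrassCurve ℚ)
    [W.IsElliptic] {f : CuspForm (CongruenceSubgroup.Gamma0 N) 2} (hf : IsNewformOf W f)
    {ℓ : ℕ} (hℓ : ℓ.Prime) (hℓN : ¬ ℓ ∣ N)
    (v : HeightOneSpectrum (𝓞 ℚ)) (hℓv : (ℓ : 𝓞 ℚ) ∈ v.asIdeal) : W.HasGoodReductionAt v := by
  have hNW : ¬ ℓ ∣ W.conductorNorm ℤ := fun h ↦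
    hℓN ((hf.dvd_level_iff_dvd_conductorNorm hℓ).mpr h)
  have hpv : (primesEquiv v : ℕ) = ℓ := primesEquiv_eq_of_natCast_mem hℓ hℓv
  set q : Nat.Primes := primesEquiv v with hq
  haveI := Fact.mk q.2
  set vZ : HeightOneSpectrum ℤ := (primesEquiv (R := ℤ)).symm q with hvZ
  have hgen : natGenerator vZ = q :=
    congrArg (fun r : Nat.Primes ↦ (r : ℕ)) ((primesEquiv (R := ℤ)).apply_symm_apply q)
  have hfe : W.conductorExponent vZ = 0 := by
    rw [← factorization_conductorNorm_holds W vZ, hgen, hpv]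
    exact Nat.factorization_eq_zero_of_not_dvd hNW
  have hgZ : W.HasGoodReductionAt vZ := (conductorExponent_eq_zero_iff_holds vZ W).mp hfe
  have hgP : W.HasGoodReductionAtPrime q :=
    (W.hasGoodReductionAtPrime_iff_hasGoodReductionAt_holds q).mpr hgZ
  exact (hasGoodReductionAtPrime_iff_hasGoodReductionAt_ringOfIntegers v W).mp hgP

/-! ## Kolyvagin primes -/

section Kolyvagin

variable {N : ℕ} [NeZero N] {W : WeierstrassCurve ℚ} [W.IsElliptic]

/-- **`E` has good reduction at every Kolyvagin prime** (Gross 1991, §3 (3.1) `ℓ ∤ N` with §1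
`N` = conductor, and §7 "with good reduction" at `λ`): if `P ∈ E(K)` is a Heegner point of level
`N` (`IsHeegnerPoint N W K P`, carrying the modular parametrisation `X₀(N) → E` and with it the
newform `f ∈ S₂(Γ₀(N))` of `W`) and `ℓ` is a Kolyvagin prime for `(N, W, K, p)`, then `W/ℚ` has
good reduction at the place `v ∋ ℓ` of `ℚ`. [cite: GrossLMS1991, §3 (3.1) with §1 and §7] -/
theorem IsKolyvaginPrime.hasGoodReductionAt_rat {K : Type u} [Field K] [NumberField K]
    {P : (W.baseChange K).toAffine.Point} (hP : IsHeegnerPoint N W K P)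
    {p ℓ : ℕ} (hℓ : IsKolyvaginPrime N W K p ℓ)
    (v : HeightOneSpectrum (𝓞 ℚ)) (hℓv : (ℓ : 𝓞 ℚ) ∈ v.asIdeal) : W.HasGoodReductionAt v := by
  obtain ⟨Dt, -, -, -⟩ := hP
  exact hasGoodReductionAt_of_isNewformOf_of_not_dvd W Dt.isNewformOf hℓ.prime hℓ.2.1 v hℓv

omit [NeZero N] [W.IsElliptic] in
/-- The place `λ = (ℓ)` of `K` lies over the place `v = λ ∩ ℚ` of `ℚ`, which contains `ℓ`.
[folklore] -/
theorem IsKolyvaginPrime.natCast_mem_under {K : Type u} [Field K] [NumberField K]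
    {p ℓ : ℕ} (hℓ : IsKolyvaginPrime N W K p ℓ) :
    (ℓ : 𝓞 ℚ) ∈ (hℓ.place.under (𝓞 ℚ)).asIdeal := by
  change (ℓ : 𝓞 ℚ) ∈ hℓ.place.asIdeal.under (𝓞 ℚ)
  rw [Ideal.under_def, Ideal.mem_comap, map_natCast]
  exact hℓ.mem_place

/-- **Base change of good reduction from `ℚ`, in any universe** (Silverman, *AEC*, VII.5.1(a)
with VIII.8.3 and VIII.1 Remark 1.3). If the elliptic `W/ℚ` has good reduction at the place `v`
and `w ∣ v` is a place of the number field `K`, then `W/K` has good reduction at `w`. Proof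
without completions: take a global minimal model `C • W = M/ℚ` with `M` over `𝓞 ℚ`
(`hasGlobalMinimalModel_rat_holds`); good reduction is isomorphism-invariant
(`hasGoodReductionAt_smul_iff_holds`) and for the minimal equation means `v(Δ_M) = 1`
(`hasGoodReductionAt_iff_of_isMinimalAt`); over `K`, `(C • W)_K = C_K • W_K` has coefficients in
`𝓞 K` (`w(aᵢ) ≤ 1`) and `w(Δ_M) = v(Δ_M)^{e(w|v)} = 1` (Mathlib `valuation_liesOver`), hence good
reduction at `w` (`hasGoodReductionAt_of_valuation_le_one_of_valuation_Δ_eq_one`), and so has `W_K`.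
[cite: SilvermanAEC2009, VII.5 Prop. 5.1(a) with VIII.8 Cor. 8.3 and VIII.1 Remark 1.3] -/
theorem hasGoodReductionAt_baseChange_of_hasGoodReductionAt_rat {K : Type u} [Field K]
    [NumberField K] (W : WeierstrassCurve ℚ) [W.IsElliptic] (v : HeightOneSpectrum (𝓞 ℚ))
    (w : HeightOneSpectrum (𝓞 K)) [w.asIdeal.LiesOver v.asIdeal] (hgood : W.HasGoodReductionAt v) :
    (W.baseChange K).HasGoodReductionAt w := by
  -- a global minimal model `C • W` over `ℚ`, with integral model `M`
  obtain ⟨C, hC⟩ := hasGlobalMinimalModel_rat_holds W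
  haveI := hC
  obtain ⟨M, hM⟩ := hC.isIntegral.integral
  have hgood' : (C • W).HasGoodReductionAt v := (hasGoodReductionAt_smul_iff_holds v W C).mpr hgood
  have hΔ : v.valuation ℚ (C • W).Δ = 1 :=
    (hasGoodReductionAt_iff_of_isMinimalAt
      (WeierstrassCurve.IsGloballyMinimal.isMinimalAt (C • W) v)).mp hgood'
  -- base change of the isomorphism `C`
  have hbc : (C • W).baseChange K = (C.map (algebraMap ℚ K)) • W.baseChange K := by
    rw [WeierstrassCurve.baseChange, WeierstrassCurve.baseChange, WeierstrassCurve.map_variableChange]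
  suffices h : ((C • W).baseChange K).HasGoodReductionAt w by
    rw [hbc] at h
    exact (hasGoodReductionAt_smul_iff_holds w (W.baseChange K) _).mp h
  -- coefficients: integers of `ℚ`, hence of `K`
  have hcoef : ∀ m : 𝓞 ℚ, w.valuation K (algebraMap ℚ K (algebraMap (𝓞 ℚ) ℚ m)) ≤ 1 := fun m ↦ by
    rw [← IsScalarTower.algebraMap_apply, IsScalarTower.algebraMap_apply (𝓞 ℚ) (𝓞 K) K]
    exact w.valuation_le_one _
  have ha : ∀ {a : ℚ} {m : 𝓞 ℚ}, a = algebraMap (𝓞 ℚ) ℚ m →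
      w.valuation K (algebraMap ℚ K a) ≤ 1 := fun {a m} h ↦ h ▸ hcoef m
  have hM₁ : (C • W).a₁ = algebraMap (𝓞 ℚ) ℚ M.a₁ := by rw [hM]; rfl
  have hM₂ : (C • W).a₂ = algebraMap (𝓞 ℚ) ℚ M.a₂ := by rw [hM]; rfl
  have hM₃ : (C • W).a₃ = algebraMap (𝓞 ℚ) ℚ M.a₃ := by rw [hM]; rfl
  have hM₄ : (C • W).a₄ = algebraMap (𝓞 ℚ) ℚ M.a₄ := by rw [hM]; rfl
  have hM₆ : (C • W).a₆ = algebraMap (𝓞 ℚ) ℚ M.a₆ := by rw [hM]; rfl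
  refine hasGoodReductionAt_of_valuation_le_one_of_valuation_Δ_eq_one w ((C • W).baseChange K)
    (ha hM₁) (ha hM₂) (ha hM₃) (ha hM₄) (ha hM₆) ?_
  -- discriminant: `w(Δ) = v(Δ)^e = 1`
  rw [WeierstrassCurve.baseChange, WeierstrassCurve.map_Δ,
    ← IsDedekindDomain.HeightOneSpectrum.valuation_liesOver K v w, hΔ, one_pow]

/-- **`λ = (ℓ)` is not a bad place of `E/K` at a Kolyvagin prime `ℓ`**: good reduction of
`W/ℚ` at `ℓ` (`IsKolyvaginPrime.hasGoodReductionAt_rat`) base-changes to good reduction of `W/K`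
at `λ ∣ ℓ` (`hasGoodReductionAt_baseChange_of_hasGoodReductionAt_rat`); `badPlaces` is the set of
places without good reduction. This is the hypothesis `λ ∉ badPlaces` of the local lemmas at `λ`
(`inertia_le_torsionFixing`, `selmerLocalKer_eq_unramifiedKer`, the tame factorization) in Gross's
§§6–8. [cite: GrossLMS1991, §3 (3.1) with §7] -/
theorem IsKolyvaginPrime.not_mem_badPlaces {K : Type u} [Field K] [NumberField K]
    {P : (W.baseChange K).toAffine.Point} (hP : IsHeegnerPoint N W K P)
    {p ℓ : ℕ} (hℓ : IsKolyvaginPrime N W K p ℓ) :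
    hℓ.place ∉ (W.baseChange K).badPlaces (𝓞 K) := by
  rw [mem_badPlaces_iff, not_not]
  haveI : hℓ.place.asIdeal.LiesOver (hℓ.place.under (𝓞 ℚ)).asIdeal := ⟨rfl⟩
  exact hasGoodReductionAt_baseChange_of_hasGoodReductionAt_rat W (hℓ.place.under (𝓞 ℚ)) hℓ.place
    (hℓ.hasGoodReductionAt_rat hP _ hℓ.natCast_mem_under)

end Kolyvagin

end Literature.NumberTheory.EllipticCurves

end
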